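import Mathlib
import Literature.NumberTheory.Transcendental.KZCalculus
import Literature.NumberTheory.Transcendental.KZLogCalculusProofs
import Literature.NumberTheory.Transcendental.KZGroundingRelations
import Literature.NumberTheory.Transcendental.KZDominatedFamilyRelations
import Literature.NumberTheory.Transcendental.KZSemialgebraicComplex
import Literature.NumberTheory.Transcendental.SemialgebraicMapsProofs

/-!
# `HyperellipticRiemannRelation` (stmt-KontsevichZagierPeriods-3522), line `SketchIdeator2`:
# representation hygiene for the stub `stub_faces`

Three general move lemmas of the Kontsevich–Zagier calculus (`KZCalculus.lean`), with no reference
to the hyperelliptic data: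

* `Faces.exists_rep_piecewise` — from ONE representation `G = [σ, g]` and a finite cover of `σ`
  by `ℚ`-semialgebraic cells `Cᵢ ⊆ σ` on each of which a function `K` is an INTEGER multiple
  `nᵢ g` of the integrand, the representation `[σ, K]` exists (semialgebraic by gluing graphs,
  `IsSemialgebraicFunOn.union`; integrable cell by cell, `MeasureTheory.integrableOn_finset_iUnion`);
* `Faces.of_sub_sum_cells_mem_relations` — cutting a representation along a finite family of
  pairwise disjoint cells covering its domain is a relation (iterated rule (1a),
  `KZ.of_sub_sum_of_mem_relations`);
* `stub_facesReps` (registered auxiliary stub) — **the shear is ONE change of variables**: for a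
  representation `H` on `{x₀ < x₁} ∖ (branch lines)` the pull-back along
  `Λ(u, τ) = (τ − u, τ)` (`|det Λ| = 1`, `ℚ`-linear) is a representation `F` on
  `{u > 0, τ ∉ E, τ − u ∉ E}` with `[F] − [H] ∈ KZ.changeOfVariablesRel ⊆ KZ.relations`
  (integrability by `MeasureTheory.integrableOn_image_iff_integrableOn_abs_det_fderiv_smul`).

No definitions are introduced. References: Kontsevich–Zagier 2001, §1.2 rules (1), (2);
Bochnak–Coste–Roy 1998, §2.2.
-/

noncomputable section

namespace Summit.KontsevichZagierPeriods.UnfoldedStokes.HyperellipticRiemannRelationLine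

open Set MeasureTheory Filter Topology
open Literature.NumberTheory.Transcendental
open Literature.ModelTheory.ExponentialFields (IsSemialgebraic)

namespace Faces

/-! ## Gluing semialgebraic functions over finitely many cells -/

/-- A function which is `ℚ`-semialgebraic on each of finitely many sets is `ℚ`-semialgebraic on
their union (the graph over the union is the union of the graphs).
[cite: BochnakCosteRoy1998, Def. 2.2.5] -/
theorem isSemialgebraicFunOn_biUnion {m : ℕ} {ι : Type*} (s : Finset ι)
    {t : ι → Set (Fin m → ℝ)} {F : (Fin m → ℝ) → ℝ}
    (h : ∀ i ∈ s, IsSemialgebraicFunOn ℚ (t i) F) :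
    IsSemialgebraicFunOn ℚ (⋃ i ∈ s, t i) F := by
  classical
  induction s using Finset.induction_on with
  | empty =>
    have h0 : (⋃ i ∈ (∅ : Finset ι), t i) = (∅ : Set (Fin m → ℝ)) := by simp
    rw [h0]
    unfold IsSemialgebraicFunOn
    convert Literature.ModelTheory.ExponentialFields.isSemialgebraic_empty
      (k := ℚ) (R := ℝ) (ι := Fin (m + 1)) using 1
    ext z
    simp
  | insert a s ha ih =>
    rw [Finset.set_biUnion_insert]
    exact (h a (Finset.mem_insert_self a s)).union
      (ih fun i hi => h i (Finset.mem_insert_of_mem hi)) (fun _ _ => rfl) (fun _ _ => rfl)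

/-! ## Representations with a piecewise-proportional integrand -/

/-- **Piecewise construction of a representation.** Let `G = [σ, g]` be a representation and
`(Cᵢ)` a finite family of `ℚ`-semialgebraic cells `Cᵢ ⊆ σ` covering `σ`. If on each cell the
function `K` is an integer multiple `nᵢ · g` of the integrand of `G`, then `[σ, K]` is a
representation: `K` is `ℚ`-semialgebraic on `σ` (cellwise products with rational constants, glued)
and absolutely integrable on `σ` (cellwise). [cite: KontsevichZagier2001, §1.1] -/
theorem exists_rep_piecewise {m : ℕ} {ι : Type*} [Fintype ι] (G : KZ.IntegralRep m)
    (C : ι → Set (Fin m → ℝ)) (hC : ∀ i, IsSemialgebraic ℚ (C i)) (hCG : ∀ i, C i ⊆ G.domain)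
    (hcov : G.domain ⊆ ⋃ i, C i) (K : (Fin m → ℝ) → ℝ)
    (hK : ∀ i, ∃ n : ℤ, EqOn K (fun x => (n : ℝ) * G.integrand x) (C i)) :
    ∃ H : KZ.IntegralRep m, H.domain = G.domain ∧ H.integrand = K := by
  classical
  have hdom : G.domain = ⋃ i ∈ (Finset.univ : Finset ι), C i := by
    apply Set.Subset.antisymm
    · intro x hx
      simpa using hcov hx
    · intro x hx
      simp only [Finset.mem_univ, iUnion_true, mem_iUnion] at hx
      obtain ⟨i, hi⟩ := hx
      exact hCG i hi
  have hsa : ∀ i, IsSemialgebraicFunOn ℚ (C i) K := by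
    intro i
    obtain ⟨n, hn⟩ := hK i
    have hg : IsSemialgebraicFunOn ℚ (C i) G.integrand :=
      G.isSemialgebraicFunOn_integrand.mono (hCG i) (hC i)
    have hc : IsSemialgebraicFunOn ℚ (C i) (fun _ => ((n : ℚ) : ℝ)) :=
      isSemialgebraicFunOn_ratCast (hC i) n
    refine (IsSemialgebraicFunOn.mul_holds hc hg).congr fun x hx => ?_
    simp only [Pi.mul_apply, Rat.cast_intCast]
    exact (hn hx).symm
  have hint : ∀ i, IntegrableOn K (C i) := by
    intro i
    obtain ⟨n, hn⟩ := hK i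
    have h1 : IntegrableOn (fun x => (n : ℝ) * G.integrand x) (C i) :=
      (G.integrableOn.mono_set (hCG i)).const_mul (n : ℝ)
    exact h1.congr_fun (fun x hx => (hn hx).symm)
      (Literature.ModelTheory.ExponentialFields.IsSemialgebraic.measurableSet_holds (hC i))
  refine ⟨⟨G.domain, K, G.isSemialgebraic_domain, ?_, ?_⟩, rfl, rfl⟩
  · rw [hdom]
    exact isSemialgebraicFunOn_biUnion _ fun i _ => hsa i
  · rw [hdom]
    exact integrableOn_finset_iUnion.mpr fun i _ => hint i

/-! ## Cutting along cells (rule 1a) -/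

/-- **Cutting a representation along finitely many cells is a relation.** If the cells `Cᵢ` are
pairwise disjoint and cover the domain of `H`, and `Rᵢ` is `H` restricted to `H.domain ∩ Cᵢ`, then
`[H] − Σᵢ [Rᵢ] ∈ KZ.relations` (iterated domain additivity, `KZ.of_sub_sum_of_mem_relations`).
[cite: KontsevichZagier2001, §1.2 rule (1)] -/
theorem of_sub_sum_cells_mem_relations {m : ℕ} {ι : Type*} [Fintype ι] (H : KZ.IntegralRep m)
    (C : ι → Set (Fin m → ℝ)) (R : ι → KZ.IntegralRep m)
    (hRd : ∀ i, (R i).domain = H.domain ∩ C i) (hRi : ∀ i, (R i).integrand = H.integrand)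
    (hcov : H.domain ⊆ ⋃ i, C i) (hdisj : ∀ i j, i ≠ j → C i ∩ C j = ∅) :
    KZ.of H - ∑ i, KZ.of (R i) ∈ KZ.relations := by
  refine KZ.of_sub_sum_of_mem_relations Finset.univ H R (fun i _ => ?_) (fun i _ x _ => ?_) ?_ ?_
  · rw [hRd, show (H.domain ∩ C i) \ H.domain = ∅ from sdiff_eq_empty.mpr inter_subset_left,
      measure_empty]
  · rw [hRi]
  · have h0 : H.domain \ ⋃ i ∈ (Finset.univ : Finset ι), (R i).domain = ∅ := by
      refine sdiff_eq_empty.mpr fun x hx => ?_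
      obtain ⟨i, hi⟩ := mem_iUnion.mp (hcov hx)
      simp only [Finset.mem_univ, iUnion_true, mem_iUnion]
      exact ⟨i, by rw [hRd]; exact ⟨hx, hi⟩⟩
    rw [h0, measure_empty]
  · intro i _ j _ hij
    have h0 : (R i).domain ∩ (R j).domain = ∅ := by
      rw [hRd, hRd]
      refine eq_empty_of_forall_notMem fun x hx => ?_
      have : x ∈ C i ∩ C j := ⟨hx.1.2, hx.2.2⟩
      rw [hdisj i j hij] at this
      exact this
    rw [h0, measure_empty]

/-! ## The shear `(u, τ) ↦ (τ − u, τ)` is one change of variables (rule 2) -/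

/-- The base `{u > 0, τ ∉ E, τ − u ∉ E}` of the simplex prism is `ℚ`-semialgebraic. [folklore] -/
theorem isSemialgebraic_shearBase (e : Fin 5 → ℚ) :
    IsSemialgebraic ℚ {y : Fin 2 → ℝ | 0 < y 0 ∧ ∀ j, y 1 ≠ (e j : ℝ) ∧ y 1 - y 0 ≠ (e j : ℝ)} := by
  have h0 : IsSemialgebraic ℚ {y : Fin 2 → ℝ | 0 < y 0} := by
    simpa using Literature.ModelTheory.ExponentialFields.isSemialgebraic_setOf_eval_pos
      (k := ℚ) (R := ℝ) (MvPolynomial.X (0 : Fin 2))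
  have h1 : ∀ j, IsSemialgebraic ℚ {y : Fin 2 → ℝ | y 1 ≠ (e j : ℝ)} := fun j => by
    have := Literature.ModelTheory.ExponentialFields.isSemialgebraic_setOf_eval_ne_zero
      (k := ℚ) (R := ℝ) (MvPolynomial.X (1 : Fin 2) - MvPolynomial.C (e j))
    simpa [sub_ne_zero] using this
  have h2 : ∀ j, IsSemialgebraic ℚ {y : Fin 2 → ℝ | y 1 - y 0 ≠ (e j : ℝ)} := fun j => by
    have := Literature.ModelTheory.ExponentialFields.isSemialgebraic_setOf_eval_ne_zero
      (k := ℚ) (R := ℝ) (MvPolynomial.X (1 : Fin 2) - MvPolynomial.X 0 - MvPolynomial.C (e j))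
    simpa [sub_ne_zero] using this
  convert h0.inter (Literature.ModelTheory.ExponentialFields.IsSemialgebraic.biInter Finset.univ _
    fun j _ => (h1 j).inter (h2 j)) using 1
  ext y
  simp

end Faces

/-- **Registered auxiliary stub `stub_facesReps` (the shear move).** For every representation `H`
on the cut simplex `{x₀ < x₁, x₀ ∉ E, x₁ ∉ E}` (`E = {e₀,…,e₄}`) there is a representation `F` on
the prism base `{u > 0, τ ∉ E, τ − u ∉ E}` with integrand `H.integrand (τ − u, τ)` and
`[F] − [H] ∈ KZ.relations`: ONE instance of Kontsevich–Zagier's rule (2) along the `ℚ`-linear shear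
`Λ(u, τ) = (τ − u, τ)`, `|det Λ| = 1`, which maps the base bijectively onto the cut simplex.
[cite: KontsevichZagier2001, §1.2 rule (2)] -/
theorem stub_facesReps :
    ∀ (e : Fin 5 → ℚ) (H : KZ.IntegralRep 2),
      H.domain = {x | x 0 < x 1 ∧ ∀ j, x 0 ≠ (e j : ℝ) ∧ x 1 ≠ (e j : ℝ)} →
      ∃ F : KZ.IntegralRep 2,
        F.domain = {y : Fin 2 → ℝ | 0 < y 0 ∧ ∀ j, y 1 ≠ (e j : ℝ) ∧ y 1 - y 0 ≠ (e j : ℝ)} ∧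
        (F.integrand = fun y => H.integrand ![y 1 - y 0, y 1]) ∧
        KZ.of F - KZ.of H ∈ KZ.relations := by
  intro e H hHd
  -- the base and the shear
  set D : Set (Fin 2 → ℝ) := {y | 0 < y 0 ∧ ∀ j, y 1 ≠ (e j : ℝ) ∧ y 1 - y 0 ≠ (e j : ℝ)}
    with hD_def
  have hD : IsSemialgebraic ℚ D := Faces.isSemialgebraic_shearBase e
  have hDm : MeasurableSet D :=
    Literature.ModelTheory.ExponentialFields.IsSemialgebraic.measurableSet_holds hD
  set M : Matrix (Fin 2) (Fin 2) ℝ := !![-1, 1; 0, 1] with hM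
  set L : (Fin 2 → ℝ) →L[ℝ] (Fin 2 → ℝ) := LinearMap.toContinuousLinearMap (Matrix.toLin' M)
    with hL
  have hLapply : ∀ y, L y = ![y 1 - y 0, y 1] := by
    intro y
    ext i
    fin_cases i
    · simp [hL, hM, Matrix.mulVec, dotProduct, Fin.sum_univ_two]
      ring
    · simp [hL, hM, Matrix.mulVec, dotProduct, Fin.sum_univ_two]
  have hdet : |L.det| = 1 := by
    have h1 : L.det = M.det := by
      rw [hL]
      change LinearMap.det ((LinearMap.toContinuousLinearMap (Matrix.toLin' M) :
        (Fin 2 → ℝ) →L[ℝ] (Fin 2 → ℝ)) : (Fin 2 → ℝ) →ₗ[ℝ] (Fin 2 → ℝ)) = M.det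
      simp [LinearMap.det_toLin']
    rw [h1, hM, Matrix.det_fin_two_of]
    norm_num
  have hinj : InjOn L D := by
    intro y _ y' _ h
    rw [hLapply, hLapply] at h
    have h0 := congr_fun h 0
    have h1 := congr_fun h 1
    simp only [Matrix.cons_val_zero, Matrix.cons_val_one] at h0 h1
    ext i
    fin_cases i
    · simp only [Fin.zero_eta, Fin.isValue]
      linarith
    · simpa using h1
  have himage : L '' D = H.domain := by
    rw [hHd]
    ext x
    simp only [mem_image, mem_setOf_eq]
    constructor
    · rintro ⟨y, ⟨hy0, hy⟩, rfl⟩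
      rw [hLapply]
      simp only [Matrix.cons_val_zero, Matrix.cons_val_one]
      exact ⟨by linarith, fun j => ⟨(hy j).2, (hy j).1⟩⟩
    · rintro ⟨hx, hx'⟩
      refine ⟨![x 1 - x 0, x 1], ⟨?_, fun j => ⟨?_, ?_⟩⟩, ?_⟩
      · simp only [Matrix.cons_val_zero]
        linarith
      · simpa using (hx' j).2
      · simp only [Matrix.cons_val_one, Matrix.cons_val_zero]
        ring_nf
        exact (hx' j).1
      · rw [hLapply]
        ext i
        fin_cases i
        · simp
        · simp
  have hLsa : IsSemialgebraicMapOn ℚ D L := by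
    refine (isSemialgebraicMapOn_aeval hD
      (![MvPolynomial.X 1 - MvPolynomial.X 0, MvPolynomial.X 1] :
        Fin 2 → MvPolynomial (Fin 2) ℚ)).congr fun y _ => ?_
    rw [hLapply]
    ext j
    fin_cases j <;> simp
  have hmaps : MapsTo L D H.domain := fun y hy => himage ▸ mem_image_of_mem L hy
  -- the pulled-back representation
  have hFsa : IsSemialgebraicFunOn ℚ D (fun y => H.integrand ![y 1 - y 0, y 1]) := by
    have := IsSemialgebraicFunOn.comp_isSemialgebraicMapOn_holds
      H.isSemialgebraicFunOn_integrand hLsa hmaps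
    exact this.congr fun y _ => by simp [Function.comp, hLapply]
  have hFint : IntegrableOn (fun y => H.integrand ![y 1 - y 0, y 1]) D := by
    have h := (integrableOn_image_iff_integrableOn_abs_det_fderiv_smul volume hDm
      (fun y _ => L.hasFDerivWithinAt) hinj H.integrand).mp (himage ▸ H.integrableOn)
    refine h.congr_fun (fun y _ => ?_) hDm
    simp [hdet, hLapply]
  let F : KZ.IntegralRep 2 :=
    { domain := D
      integrand := fun y => H.integrand ![y 1 - y 0, y 1]
      isSemialgebraic_domain := hD
      isSemialgebraicFunOn_integrand := hFsa
      integrableOn := hFint }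
  refine ⟨F, rfl, rfl, ?_⟩
  refine KZ.changeOfVariablesRel_subset_relations ⟨2, F, H, L, fun _ => L, hLsa,
    fun y _ => L.hasFDerivWithinAt, hinj, himage.symm, fun y _ => ?_, rfl⟩
  change H.integrand ![y 1 - y 0, y 1] = H.integrand (L y) * |L.det|
  rw [hdet, mul_one, hLapply]

end Summit.KontsevichZagierPeriods.UnfoldedStokes.HyperellipticRiemannRelationLine
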